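import Mathlib
import Literature.Analysis.FluidPDE.WeakSolution
import Literature.Claims.NS.ClayVariants
import HarnessLib

/-!
# Claim skeleton (D-0090 NS-CLAIMS, C01): Otelbaev 2013 — strong solvability of periodic NS via an
# abstract Hilbert-space a priori estimate

Typed skeleton of M. Otelbaev, *Существование сильного решения уравнения Навье–Стокса* (Existence of a
strong solution of the Navier–Stokes equation), Matematicheskii Zhurnal (Almaty) **13** (2013) no. 4 (50),
5–104, Russian (bib `Otelbaev2013`; page numbers below are the JOURNAL pages; version of record = the
math.kz PDF, sha256 `ef6dd821…8774`; statements read on the page renders and in the cell's TRANSLATION.md).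
DISPUTED CLAIM under adjudication — the decisive inequality was withdrawn by the author on 2014-02-14
("on the page 56 the inequality (6.34) is incorrect therefore the proposition 6.3 (p. 54) isn't proved",
[cite: MontgomerySmith2014Otelbaev, Update 3]) after counterexamples to the abstract Theorem 6.1 were posted
([cite: DxdyTopic80156, post 817605 (2014-01-21)], an `ℓ₂` instance; [cite: MontgomerySmith2014Otelbaev, Update 2],
T. Tao's `ℝ^N` instance). NOTHING in this file asserts a step of the paper: the paper's statements are
`def … : Prop`; the only `theorem`s are the kernel composition of the paper's OWN implications and two
one-line logical relations. Verdict vocabulary is the refuter's / referee's.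

## The claimed statement (Theorem 1, p. 10), as printed
`Q = (−π, π)³`, `Ω = (0, a) × Q`, `a > 0`; system (1.1) `∂ₜu_j + Σ_k u_k ∂_k u_j = Δu_j − ∂_j p + f_j`,
`div u = 0` on `Ω`, viscosity `ν = 1` (p. 7); zero initial datum (1.2) `u|_{t=0} = 0` ("without loss of
generality", p. 7); periodic boundary conditions (1.3) for `u`, `p`, `∂u/∂x_k`; pressure normalisation (1.4)
`∫_Q p(t, x) dx = p₀`, `p₀ = const > 0` (p. 8). DEFINITION 1 (p. 9): a solution `(u; p)` is STRONG if
`∂u/∂t, Δu, ⟨u,∇⟩u, grad p ∈ L₂(Ω)`. THEOREM 1 (p. 10): "For every `f ∈ L₂(Ω)` problem (1.1)–(1.4) has a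
unique strong solution `(u; p)`, and (2.2) `‖∂u/∂t‖ + ‖Δu‖ + ‖(u,∇)u‖ + ‖grad p‖ ≤ C (1 + ‖f‖ + ‖f‖^l)`
holds, where `‖·‖` is the norm of `L₂(Ω)` and the constants `C > 0`, `l ≥ 1` do not depend on `f`."
Followed by: "This theorem gives a complete solution of the sixth Millennium problem" (p. 10, l. 6–9; no
derivation printed) — typed as `ClayDelta` below. Typed here: `ClaimedTheorem` (2π-periodic fields on `ℝ³`,
distributional solution on the open slab `(0, a) × ℝ³` in the tree's sense
`Literature.Analysis.FluidPDE.IsDistributionalNSSolutionOn`, with the four weak derivatives of Definition 1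
square integrable over one period cell `Ω`, zero trace at `t = 0`, (1.4) for a.e. `t`).

## Clay delta (axes of `Literature.Claims.NS.ClayVariants`, §3 of that module's docstring)
Nearest Clay statement: (B) `ClayVariants.clayPeriodic.Regularity`. As printed, Theorem 1 is NOT (B):
Δ1 DOMAIN period `2π` (scaling; harmless) · Δ3 FORCE arbitrary `f ∈ L₂((0,a) × Q)` (stronger side than (B)'s
`f ≡ 0`) · Δ4 DATA zero datum only — the reduction of a smooth datum to zero datum + force is asserted
("without loss of generality", p. 7), not printed · Δ5 SOLUTION NOTION `L₂`-strong (Def. 1) + uniqueness, no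
`C^∞` claim · Δ7 QUANTIFIERS every finite horizon `a`, `ν = 1`. `clay_of_claimed` is therefore NOT a
one-liner; the unprinted bridge "Theorem 1 ⇒ (B)" is the typed `ClayDelta` (`clay_of_claimed_of_delta`).
The 2014 readers did not locate the failure on these axes ([cite: MontgomerySmith2014Otelbaev, question thread]).

## The paper's architecture and the Steps (dependency order = the order the printed proof establishes them)
The proof is a chain of four printed implications/assertions:
* Step 1 = `Theorem61` — THEOREM 6.1 (p. 29; proof pp. 30–71): the abstract "weak estimate ⇒ strong
  estimate" bound under conditions (У.1)–(У.4) (p. 28) with constants `C₁, l` depending ONLY on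
  `(C_β, β, C_θ, θ)` (p. 29 last sentence of the statement; p. 62: "the value of our theorem is precisely that
  `C₁` and `l` do not depend on the dimension") — typed in the PRINTED quantifier order
  `∀ (β, C_β, θ, C_θ) ∃ (C₁, l) ∀ (Ĥ, A, L) ∀ ů`. Proof-internal locator recorded, not typed: Lemma 6.10
  (pp. 46–47) ⇐ Proposition 6.3 (p. 54) ⇐ the passage (6.33) → (6.34) (p. 56), withdrawn by the author
  (above); it lives on the auxiliary objects `R, S, K, K̃, μ̃, M_u, P_u` of pp. 30, 48 and is not a
  closed statement of its own.
* Step 2 = `Theorem62_of_Theorem61` — pp. 71–73: "Now we must get rid of condition (У.4)": for `L`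
  satisfying (У.1)–(У.3), `L̃(u,v) = (E−P)L((E−P)u,(E−P)v)` satisfies (У.1)–(У.4), Theorem 6.1 applies to it,
  and (У.5) converts the bound: THEOREM 6.2 (pp. 72–73) follows from THEOREM 6.1. The consequent
  `Theorem62` is typed standalone as well — it is the statement §7 CONSUMES (load-bearing in the sense of the
  cell's MAP-SCHEMA §1b).
* Step 3 = `Theorem2_of_Theorem62` — §7 (pp. 73–91), first sentence: "In this section we derive Theorem 2
  from Theorem 6.2" (p. 73); the use is in Lemma 7.15 (p. 84: "it suffices to check conditions (У.1), (У.2),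
  (У.3), (У.5) of §6 with `L = B̃`; then the needed estimate follows from Theorem 6.2"), then Lemma 7.16
  (pp. 84–86, general `A`), Lemma 7.17 (pp. 86–90, existence by continuation), proof of Theorem 2 pp. 90–91.
  The consequent `Theorem2I` = THEOREM 2 part I (p. 13) is typed standalone (abstract problem (3.4) under
  Conditions A, B1–B4 of pp. 10–13, in the eigenbasis coordinates of p. 11).
* Step 4 = `Theorem1_of_Theorem2` — §4 (pp. 14–23), "Derivation of the main Theorem 1 from Theorem 2",
  closing sentence p. 23: "Thus Theorem 1 follows from Theorem 2": the instance `H = L̃₂(Q)` (divergence-free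
  periodic `L₂`), `A = E − Δ`, `B(u,v) = eᵗ F⟨u,∇⟩v` after the substitution `u = v eᵗ` (p. 17; `F` = the
  projector (4.3)), Conditions A, B1–B4 verified on pp. 18–23 (Lemmas 4.1–4.5, proved in §8), pressure from
  (4.4) + (1.4). Typed as the printed implication; the instance is recorded here, not built (it needs the
  torus Leray projector as an operator on `L̃₂(Q)`; note the typing delta that `B` of §4 carries the
  time-dependent factor `eᵗ` while Theorem 2 is stated for one bilinear `B`).
COMPOSITION: proved as `claim_of_steps : Theorem61 → Theorem62_of_Theorem61 → Theorem2_of_Theorem62 →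
Theorem1_of_Theorem2 → ClaimedTheorem` (pure logic; every hypothesis used). Standalone refutation targets,
all closed `Prop`s with explicit quantifier order: `Theorem61` (p. 29), `Theorem62` (p. 72), `Theorem2I`
(p. 13), `ClaimedTheorem` (p. 10); charitable per-space reading `Theorem61PerSpace` (NOT the print; for the
referee's RETYPE; `theorem61PerSpace_of_theorem61`).

## Typing conventions used (cell TYPING-HYGIENE)
* The abstract operator `A` of §6 / §3 is given through an orthonormal eigenbasis (`HilbertBasis`) and an
  eigenvalue function `eig` (p. 11: "`Aφ = Σ λ_j φ_j e_j` … `A_μ^α φ = Σ (λ_j − μ₀ + 1)^α φ_j e_j`"; p. 28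
  (У.3): "`Ĥ` is the orthogonal sum of the eigenspaces"); powers of `A` are typed RELATIONALLY on
  coefficients (`IsPow s u w : ∀ i, ⟪e_i, w⟫ = λ_i^s ⟪e_i, u⟫`), so no `tsum`/junk value occurs and
  finite-dimensional diagonal models (`EuclideanSpace ℝ (Fin N)`) and `ℓ²` models instantiate directly;
  the orthogonal projector onto the bottom eigenspace is typed the same way (`IsProjG1`, `IsProjBottom`).
* `⟨Au, u⟩ ≥ ‖u‖²` ((У.1), first inequality) is typed as `∀ i, 1 ≤ eig i` (equivalent for a diagonal `A`:
  take `u = e_i`; conversely termwise).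
* (У.3) "the spectrum consists of a sequence `1 ≡ λ₁ < λ₂ < … `, `16 ≤ λ₂ ≤ 100`, … `dim G_{λ₁} ≥ 20`" is
  typed as: `1` is the least eigenvalue, the second distinct eigenvalue exists and lies in `[16, 100]`,
  at least `20` basis vectors have eigenvalue `1`, and only finitely many distinct eigenvalues lie below any
  level (a strictly increasing enumeration of a closed spectrum has no finite accumulation point);
  eigenspaces of any dimension, `dim Ĥ ≤ ∞` — all as printed.
* `L₂(Ω)` norms are `(eLpNorm … 2 …).toReal` used only next to the corresponding `MemLp` hypotheses;
  `H₁(0,a) = L²(0,a; H)` likewise; Condition B4's inequality is typed in `ℝ≥0∞` (no junk); the supremum in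
  Theorem 2 (I) is typed as an explicit bound `M₀` (no `sSup`).
* Exponents `l, m, n` and constants are real numbers (`Real.rpow`), unconstrained unless the print constrains
  them (Theorem 1: `C > 0`, `l ≥ 1`; (У.5): `n ≥ 0`, `C_P > 0`).

Mechanism in print (context, not used in the typing): the abstract-approach barrier
[cite: Tao2016AveragedNS, §1] (tree: `Literature.Analysis.FluidPDE.Tao2016.averagedNS_blowup_holds`,
barrier `Literature.Barriers.NavierStokesRegularity.TaoAveragedBlowup`); the attribution to this paper is
printed in [cite: LemarieRieusset2016, §11.2 p.315 and §20.3 pp.710–711]; Tao's blog note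
[cite: Tao2014AveragedNSBlog, ¶1] does not name the paper. Tao's averaged operator lives on `ℝ³`
(continuous spectrum) and does not instantiate (У.3); the 2014 finite-dimensional instances do.

WHAT THIS IS NOT: not a claim about NS regularity or blow-up; not a claim about any author beyond the typed
locator.
-/

noncomputable section

open MeasureTheory TopologicalSpace Set Function Real
open scoped Laplacian InnerProductSpace RealInnerProductSpace ENNReal ContDiff

namespace Literature.Claims.NS.Otelbaev2013

open Literature.Analysis.FluidPDE

/-! ## Part I — the Navier–Stokes statement (§1–§2, pp. 7–10) -/

/-- Physical space `ℝ³` (plumbing abbreviation). [folklore] -/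
abbrev E3 : Type := EuclideanSpace ℝ (Fin 3)

/-- Periodicity with period `2π` in each coordinate direction — the periodic boundary conditions (1.3)
(p. 8) for fields on the cube `Q` of edge `2π` centred at `0` (p. 7), read as fields on `ℝ³`.
[cite: Otelbaev2013, (1.3) p.8] -/
def IsTwoPiPeriodic {F : Type*} (v : E3 → F) : Prop :=
  ∀ (j : Fin 3) (x : E3), v (x + EuclideanSpace.single j (2 * π)) = v x

/-- The open cube `Q = (−π, π)³` (p. 7: "the three-dimensional cube centred at zero with edges of length
`2π` parallel to the coordinate axes"). [cite: Otelbaev2013, §1.2 p.7] -/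
def cube : Set E3 := {x | ∀ j : Fin 3, x j ∈ Ioo (-π) π}

/-- The space–time cylinder `Ω = (0, a) × Q` (p. 7). [cite: Otelbaev2013, §1.2 p.7] -/
def cyl (a : ℝ) : Set (ℝ × E3) := Ioo 0 a ×ˢ cube

/-- The open slab `(0, a) × ℝ³` (time first), on which the periodic extension of a solution lives; the
tree's `slab`. [cite: Otelbaev2013, §1.2 p.7] -/
def slabIoo (a : ℝ) : Opens (ℝ × E3) := slab E3 (Ioo 0 a) isOpen_Ioo

/-- The underlying set `(0, a) × ℝ³` of the slab. [cite: Otelbaev2013, §1.2 p.7] -/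
def slabSet (a : ℝ) : Set (ℝ × E3) := Ioo 0 a ×ˢ univ

/-- Membership in `L₂(Ω)` (p. 8, §1.3: "`L₂(Ω)` … the Lebesgue Hilbert space of vector-functions with
`(f, g) = ∫₀ᵃ ∫_Q ⟨f, g⟩ dx dt`"), for a time-dependent field given on all of `ℝ × ℝ³`.
[cite: Otelbaev2013, §1.3 p.8] -/
def MemL2 (a : ℝ) {F : Type*} [NormedAddCommGroup F] (g : ℝ → E3 → F) : Prop :=
  MemLp (uncurry g) 2 (volume.restrict (cyl a))

/-- The norm `‖g‖` of `L₂(Ω)` (p. 8) as a real number (`toReal` of the extended `L²` norm over one period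
cell; used only next to the corresponding `MemL2` hypothesis, where it is the honest norm).
[cite: Otelbaev2013, §1.3 p.8] -/
def l2Norm (a : ℝ) {F : Type*} [NormedAddCommGroup F] (g : ℝ → E3 → F) : ℝ :=
  (eLpNorm (uncurry g) 2 (volume.restrict (cyl a))).toReal

/-- `w = ∂u/∂t` in the weak sense on the open slab `(0,a) × ℝ³`: both locally integrable there and
`∫∫ (∂ₜθ) u = −∫∫ θ w` for every scalar test function `θ` supported in the slab (Definition 1, p. 9, lists
`∂u/∂t ∈ L₂(Ω)` for an `L₂`-class solution, i.e. the distributional derivative). [cite: Otelbaev2013, Def. 1 p.9] -/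
def IsWeakTimeDeriv (a : ℝ) (u w : ℝ → E3 → E3) : Prop :=
  LocallyIntegrableOn (uncurry u) (slabSet a) volume ∧ LocallyIntegrableOn (uncurry w) (slabSet a) volume ∧
    ∀ θ : ℝ → E3 → ℝ, IsSpaceTimeTestOn (slabIoo a) θ →
      ∫ z in slabSet a, (timeDeriv θ z.1 z.2) • u z.1 z.2 = -∫ z in slabSet a, (θ z.1 z.2) • w z.1 z.2

/-- `G = ∇ₓu` (all first space derivatives) in the weak sense on the slab: `G` locally integrable in each
direction and `∫∫ (∂_v θ) u = −∫∫ θ (G v)` for scalar tests `θ` and directions `v` (needed to give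
`⟨u, ∇⟩u` of Definition 1 a meaning). [cite: Otelbaev2013, Def. 1 p.9] -/
def IsWeakSpaceFDeriv (a : ℝ) (u : ℝ → E3 → E3) (G : ℝ → E3 → (E3 →L[ℝ] E3)) : Prop :=
  LocallyIntegrableOn (uncurry u) (slabSet a) volume ∧
    (∀ v : E3, LocallyIntegrableOn (fun z : ℝ × E3 => G z.1 z.2 v) (slabSet a) volume) ∧
    ∀ θ : ℝ → E3 → ℝ, IsSpaceTimeTestOn (slabIoo a) θ → ∀ v : E3,
      ∫ z in slabSet a, (fderiv ℝ (θ z.1) z.2 v) • u z.1 z.2 = -∫ z in slabSet a, (θ z.1 z.2) • G z.1 z.2 v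

/-- `w = Δu` in the weak sense on the slab: `∫∫ (Δθ) u = ∫∫ θ w` for scalar tests `θ` (Definition 1:
`Δu ∈ L₂(Ω)`). [cite: Otelbaev2013, Def. 1 p.9] -/
def IsWeakLaplacian (a : ℝ) (u w : ℝ → E3 → E3) : Prop :=
  LocallyIntegrableOn (uncurry u) (slabSet a) volume ∧ LocallyIntegrableOn (uncurry w) (slabSet a) volume ∧
    ∀ θ : ℝ → E3 → ℝ, IsSpaceTimeTestOn (slabIoo a) θ →
      ∫ z in slabSet a, (Δ (θ z.1) z.2) • u z.1 z.2 = ∫ z in slabSet a, (θ z.1 z.2) • w z.1 z.2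

/-- `g = grad p` in the weak sense on the slab: `∫∫ (∂_v θ) p = −∫∫ θ ⟨g, v⟩` for scalar tests `θ` and
directions `v` (Definition 1: `grad p ∈ L₂(Ω)`). [cite: Otelbaev2013, Def. 1 p.9] -/
def IsWeakGrad (a : ℝ) (p : ℝ → E3 → ℝ) (g : ℝ → E3 → E3) : Prop :=
  LocallyIntegrableOn (uncurry p) (slabSet a) volume ∧ LocallyIntegrableOn (uncurry g) (slabSet a) volume ∧
    ∀ θ : ℝ → E3 → ℝ, IsSpaceTimeTestOn (slabIoo a) θ → ∀ v : E3,
      ∫ z in slabSet a, (fderiv ℝ (θ z.1) z.2 v) * p z.1 z.2 = -∫ z in slabSet a, θ z.1 z.2 * ⟪g z.1 z.2, v⟫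

/-- The initial condition (1.2) `u|_{t=0} = 0` for an `L₂`-class `u` with weak time derivative `w`, in trace
form: `∫∫_{(0,a)×ℝ³} ((∂ₜθ) u + θ w) = 0` for every scalar test function `θ` supported in `(−∞, a) × ℝ³`
(the boundary term `−∫ θ(0,x) u(0,x) dx` vanishes). [cite: Otelbaev2013, (1.2) p.7] -/
def HasZeroInitialTrace (a : ℝ) (u w : ℝ → E3 → E3) : Prop :=
  ∀ θ : ℝ → E3 → ℝ, IsSpaceTimeTestOn (slab E3 (Iio a) isOpen_Iio) θ →
    ∫ z in slabSet a, ((timeDeriv θ z.1 z.2) • u z.1 z.2 + (θ z.1 z.2) • w z.1 z.2) = 0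

/-- **Strong solution of problem (1.1)–(1.4)** (Definitions 1–2, p. 9) with force `f`, horizon `a`, pressure
constant `p₀`, written out with its four weak derivatives `ut = ∂ₜu`, `G = ∇ₓu` (so `⟨u,∇⟩u = G(u)`),
`Lu = Δu`, `gp = grad p`: `u(t,·)`, `p(t,·)` are `2π`-periodic (1.3); `(u; p)` solves (1.1) with `ν = 1`
in the sense of distributions on `(0,a) × ℝ³` (tree predicate `IsDistributionalNSSolutionOn`, which includes
`div u = 0`); the four derivatives exist weakly and lie in `L₂(Ω)` (Definition 1); zero initial trace
(1.2); `∫_Q p(t,x) dx = p₀` for a.e. `t` (1.4). [cite: Otelbaev2013, Def. 1 p.9] -/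
structure IsStrongSolution (a p₀ : ℝ) (f u : ℝ → E3 → E3) (p : ℝ → E3 → ℝ)
    (ut : ℝ → E3 → E3) (G : ℝ → E3 → (E3 →L[ℝ] E3)) (Lu gp : ℝ → E3 → E3) : Prop where
  periodic_u : ∀ t ∈ Ioo 0 a, IsTwoPiPeriodic (u t)
  periodic_p : ∀ t ∈ Ioo 0 a, IsTwoPiPeriodic (p t)
  solves : IsDistributionalNSSolutionOn (slabIoo a) 1 f u p
  weakTimeDeriv : IsWeakTimeDeriv a u ut
  weakSpaceDeriv : IsWeakSpaceFDeriv a u G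
  weakLaplacian : IsWeakLaplacian a u Lu
  weakPressureGrad : IsWeakGrad a p gp
  memL2_timeDeriv : MemL2 a ut
  memL2_laplacian : MemL2 a Lu
  memL2_convection : MemL2 a (fun t x => G t x (u t x))
  memL2_pressureGrad : MemL2 a gp
  initial : HasZeroInitialTrace a u ut
  pressure_normalisation : ∀ᵐ t ∂(volume.restrict (Ioo 0 a)), IntegrableOn (p t) cube volume ∧
    ∫ x in cube, p t x = p₀

/-- **THEOREM 1 (p. 10), the claimed statement, as printed.** For every `a > 0` and `p₀ > 0` (data of the
problem, pp. 7–8) there are `C > 0` and `l ≥ 1`, not depending on `f`, such that for every `f ∈ L₂(Ω)`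
(`2π`-periodic in `x`): problem (1.1)–(1.4) has a strong solution `(u; p)` obeying (2.2)
`‖∂ₜu‖ + ‖Δu‖ + ‖(u,∇)u‖ + ‖grad p‖ ≤ C (1 + ‖f‖ + ‖f‖^l)` (norms of `L₂(Ω)`), and the strong solution
is unique (`u`, `p` determined a.e. on `(0,a) × ℝ³`). [claim: Otelbaev2013, status: disputed]
[cite: Otelbaev2013, Thm 1 (2.2) p.10] -/
def ClaimedTheorem : Prop :=
  ∀ a : ℝ, 0 < a → ∀ p₀ : ℝ, 0 < p₀ → ∃ C : ℝ, 0 < C ∧ ∃ l : ℝ, 1 ≤ l ∧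
    ∀ f : ℝ → E3 → E3, (∀ t ∈ Ioo 0 a, IsTwoPiPeriodic (f t)) → MemL2 a f →
      (∃ (u : ℝ → E3 → E3) (p : ℝ → E3 → ℝ) (ut : ℝ → E3 → E3) (G : ℝ → E3 → (E3 →L[ℝ] E3))
          (Lu gp : ℝ → E3 → E3),
        IsStrongSolution a p₀ f u p ut G Lu gp ∧
          l2Norm a ut + l2Norm a Lu + l2Norm a (fun t x => G t x (u t x)) + l2Norm a gp ≤
            C * (1 + l2Norm a f + l2Norm a f ^ l)) ∧
      ∀ (u₁ : ℝ → E3 → E3) (p₁ : ℝ → E3 → ℝ) (ut₁ : ℝ → E3 → E3) (G₁ : ℝ → E3 → (E3 →L[ℝ] E3))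
        (Lu₁ gp₁ : ℝ → E3 → E3) (u₂ : ℝ → E3 → E3) (p₂ : ℝ → E3 → ℝ) (ut₂ : ℝ → E3 → E3)
        (G₂ : ℝ → E3 → (E3 →L[ℝ] E3)) (Lu₂ gp₂ : ℝ → E3 → E3),
        IsStrongSolution a p₀ f u₁ p₁ ut₁ G₁ Lu₁ gp₁ → IsStrongSolution a p₀ f u₂ p₂ ut₂ G₂ Lu₂ gp₂ →
          uncurry u₁ =ᵐ[volume.restrict (slabSet a)] uncurry u₂ ∧
            uncurry p₁ =ᵐ[volume.restrict (slabSet a)] uncurry p₂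

/-! ## Part II — the abstract a priori estimate of §6 (pp. 27–29, 71–73)

Setting (p. 27 l.−3 – p. 28 l.3): `Ĥ` a real Hilbert space, `A` self-adjoint on `Ĥ` with `Ĥ` the orthogonal
sum of its eigenspaces ((У.3)), `L(·,·)` bilinear and continuous; `L_u g = L(u,g) + L(g,u)`, `L_u^*` its
adjoint; `f(u) = u + L(u,u)` (p. 30). `A` is given by an orthonormal eigenbasis `basis` and eigenvalues
`eig` (every such pair defines a self-adjoint `A` with `Ĥ = ⊕ G_λ`; conversely (У.3) provides one). -/

/-- The data `(Ĥ, A, L)` of §6 (pp. 27–28): an orthonormal eigenbasis of `A` (a `HilbertBasis`, so `Ĥ` is the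
orthogonal sum of the eigenspaces, (У.3)), the eigenvalue of each basis vector, and the bilinear map `L`
(its continuity, p. 27, follows from (У.1) and is not recorded separately). Finite-dimensional models: any
`OrthonormalBasis` gives a `HilbertBasis` by `OrthonormalBasis.toHilbertBasis`, and
`HilbertBasis.repr_apply_apply : b.repr v i = ⟪b i, v⟫`. [cite: Otelbaev2013, §6 pp.27–28] -/
structure Setting (ι H : Type) [NormedAddCommGroup H] [InnerProductSpace ℝ H] where
  /-- orthonormal eigenbasis `{e_i}` of `A` spanning `Ĥ` -/
  basis : HilbertBasis ι ℝ H
  /-- `A e_i = eig i • e_i` -/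
  eig : ι → ℝ
  /-- the bilinear transformation `L(·,·)` -/
  L : H →ₗ[ℝ] H →ₗ[ℝ] H

namespace Setting

variable {ι H : Type} [NormedAddCommGroup H] [InnerProductSpace ℝ H] (S : Setting ι H)

/-- `w = A^s u` in eigen-coordinates: `⟪e_i, w⟫ = λ_i^s ⟪e_i, u⟫` for every `i` (p. 11: powers of `A` "in the
sense of the spectral decomposition"; in §6 only negative powers `A^β`, `A^θ`, `A^{2θ}` occur, which are
bounded since `λ_i ≥ 1`). [cite: Otelbaev2013, §3 p.11] -/
def IsPow (s : ℝ) (u w : H) : Prop :=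
  ∀ i : ι, ⟪S.basis i, w⟫ = S.eig i ^ s * ⟪S.basis i, u⟫

/-- `f(u) = u + L(u,u)` (p. 30, (6.2); in Theorem 6.1 `f̊ = ů + L(ů, ů)`). [cite: Otelbaev2013, (6.1) p.29] -/
def nl (u : H) : H := u + S.L u u

/-- `L_u g = L(u, g) + L(g, u)` (p. 28 l.3). [cite: Otelbaev2013, §6 p.28] -/
def Lsym (u g : H) : H := S.L u g + S.L g u

/-- The bottom eigenspace `G_{λ₁} ≡ G₁ = {x : Ax = x}` ((У.3)/(У.4), p. 28): vectors whose coefficients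
vanish off the eigenvalue-`1` basis vectors. [cite: Otelbaev2013, (У.4) p.28] -/
def G1 : Set H := {u | ∀ i : ι, ⟪S.basis i, u⟫ ≠ 0 → S.eig i = 1}

/-- "`u` is an eigenvector of `A` (`Au = λu`)" ((У.2), p. 28): all non-zero coefficients of `u` sit on basis
vectors of one eigenvalue `λ` (the zero vector is harmlessly included: (У.2)'s conclusion is trivial for it).
[cite: Otelbaev2013, (У.2) p.28] -/
def IsEigenvector (u : H) : Prop :=
  ∃ lam : ℝ, ∀ i : ι, ⟪S.basis i, u⟫ ≠ 0 → S.eig i = lam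

/-- **Condition (У.1)** (p. 28): "for some `−∞ < β < 0` and all `v, u ∈ Ĥ`: `⟨Au, u⟩ ≥ ‖u‖²` and
`‖L(u, ϑ)‖ ≤ C_β ‖A^β u‖ ‖A^β ϑ‖`, `C_β` not depending on `u, ϑ`." First inequality ⇔ every eigenvalue is
`≥ 1` (diagonal `A`); `β < 0` is imposed where (У.1) is used (`Theorem61`). [cite: Otelbaev2013, (У.1) p.28] -/
def Y1 (β Cβ : ℝ) : Prop :=
  (∀ i : ι, 1 ≤ S.eig i) ∧
    ∀ u v wu wv : H, S.IsPow β u wu → S.IsPow β v wv → ‖S.L u v‖ ≤ Cβ * ‖wu‖ * ‖wv‖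

/-- **Condition (У.2)** (p. 28): "if `u` is an eigenvector of `A` (`Au = λu`) then `⟨u, L(u,u)⟩ = 0`."
[cite: Otelbaev2013, (У.2) p.28] -/
def Y2 : Prop :=
  ∀ u : H, S.IsEigenvector u → ⟪u, S.L u u⟫ = 0

/-- **Condition (У.3)** (p. 28): "the spectrum of `A` consists of a sequence `1 ≡ λ₁ < λ₂ < λ₃ < … < λ_n <
λ_{n+1} < …`, `16 ≤ λ₂ ≤ 100`, such that `Ĥ = ⊕_j G_{λ_j}` with eigenspaces `G_{λ_j}` (finite- or
infinite-dimensional), `M = dim Ĥ ≤ ∞`; moreover `dim G_{λ₁} ≥ 20`." Typed: `1` is an eigenvalue and the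
least one; a second distinct eigenvalue `λ₂ ∈ [16, 100]` exists with nothing strictly between `1` and `λ₂`;
at least `20` basis vectors carry eigenvalue `1`; below every level there are finitely many distinct
eigenvalues (strictly increasing enumeration of the closed spectrum). [cite: Otelbaev2013, (У.3) p.28] -/
def Y3 : Prop :=
  (∃ i : ι, S.eig i = 1) ∧ (∀ i : ι, 1 ≤ S.eig i) ∧
    (∃ lam₂ : ℝ, 16 ≤ lam₂ ∧ lam₂ ≤ 100 ∧ (∃ i : ι, S.eig i = lam₂) ∧
      ∀ i : ι, S.eig i = 1 ∨ lam₂ ≤ S.eig i) ∧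
    (∃ e : Fin 20 → ι, Injective e ∧ ∀ k, S.eig (e k) = 1) ∧
    ∀ R : ℝ, (range S.eig ∩ Iic R).Finite

/-- **Condition (У.4)** (p. 28): "if `u ∈ Ĥ`, `e ∈ G₁ = {x : Ax = x}`, then
`L(e,u) = L(u,e) = L_u e = L_u^* e = L_e u = L_e^* u = 0`" — the two adjoint identities unfolded as
`⟪L_u g, e⟫ = 0`, `⟪L_e g, u⟫ = 0` for all `g`. [cite: Otelbaev2013, (У.4) p.28] -/
def Y4 : Prop :=
  ∀ e ∈ S.G1, ∀ u : H,
    S.L e u = 0 ∧ S.L u e = 0 ∧ S.Lsym u e = 0 ∧ (∀ g : H, ⟪S.Lsym u g, e⟫ = 0) ∧ S.Lsym e u = 0 ∧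
      ∀ g : H, ⟪S.Lsym e g, u⟫ = 0

/-- "`P` is the orthogonal projector onto `G_{λ₁}`" (p. 71), in coefficients: `P u` keeps the eigenvalue-`1`
coefficients of `u` and kills the others. [cite: Otelbaev2013, §6 p.71] -/
def IsProjG1 (P : H →ₗ[ℝ] H) : Prop :=
  ∀ (u : H) (i : ι), ⟪S.basis i, P u⟫ = if S.eig i = 1 then ⟪S.basis i, u⟫ else 0

/-- `L_P(u,v) = (E − P)(L(Pu, v) + L(u, Pv) + L(Pu, Pv)) + P L(u, v)` (p. 71, as printed — [sic]: with
`+ L(Pu,Pv)`; the identity `f(u) = u + L̃(u,u) + L_P(u,u)` used on p. 73 would need `− L(Pu,Pv)`; immaterial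
for any `L` vanishing when an argument lies in `G₁` with `P L = 0`). [cite: Otelbaev2013, §6 p.71] -/
def LP (P : H →ₗ[ℝ] H) (u v : H) : H :=
  (S.L (P u) v + S.L u (P v) + S.L (P u) (P v)) - P (S.L (P u) v + S.L u (P v) + S.L (P u) (P v)) +
    P (S.L u v)

/-- **Condition (У.5)** (p. 72, (6.58)): "for some constants `n ≥ 0` and `C_P > 0`:
`‖L_P(u,u)‖ ≤ C_P (‖u + L(u,u)‖ + ‖u + L(u,u)‖^n)`" (for all `u`; `P` = the projector onto `G_{λ₁}`).
[cite: Otelbaev2013, (У.5) (6.58) p.72] -/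
def Y5 (n CP : ℝ) : Prop :=
  0 ≤ n ∧ 0 < CP ∧ ∀ P : H →ₗ[ℝ] H, S.IsProjG1 P → ∀ u : H, ‖S.LP P u u‖ ≤ CP * (‖S.nl u‖ + ‖S.nl u‖ ^ n)

/-- The WEAK ESTIMATE of Theorems 6.1/6.2: "`‖A^θ ů‖ ≤ C_θ`" (p. 29) — `A^θ ů` exists (it always does for
`θ < 0`, `λ_i ≥ 1`) and has norm at most `C_θ`. [cite: Otelbaev2013, Thm 6.1 p.29] -/
def WeakEstimate (θ Cθ : ℝ) (u : H) : Prop :=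
  ∃ w : H, S.IsPow θ u w ∧ ‖w‖ ≤ Cθ

end Setting

/-- **Step 1 — THEOREM 6.1 (p. 29), as printed, in the printed quantifier order.** "Let conditions (У.1),
(У.2), (У.3) and (У.4) hold. Suppose that for some `ů ∈ Ĥ` the weak estimate `‖A^θ ů‖ ≤ C_θ` holds, where
`θ < min(−3/4, β)` and `β` is from (У.1). Then for `ů` the strong estimate (6.1)
`‖ů‖ ≤ C₁ (1 + ‖f̊‖ + ‖f̊‖^l)`, `f̊ = ů + L(ů, ů)`, holds. Here `C₁` and `l` depend ONLY on `C_β` and `β`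
from (У.1) and on `C_θ` and `θ`." (so: `∀ (β, C_β, θ, C_θ) ∃ (C₁, l) ∀ (Ĥ, A, L)` with (У.1)–(У.4) for
these constants `∀ ů`; p. 62: "one can always get an estimate of the form (6.1) with dimension-dependent
constants; the value of our theorem is precisely that `C₁` and `l` do not depend on the dimension of `Ĥ`").
Printed proof: pp. 30–71 (finite-dimensional case pp. 62–68 via Corollary 6.1 p. 61 ⇐ Lemma 6.10 pp. 46–60
⇐ Proposition 6.3 p. 54 ⇐ (6.32) & (6.34) p. 56; general case by `P_N`-truncation pp. 69–71); the passage
(6.33) → (6.34), p. 56, was withdrawn by the author on 2014-02-14 [cite: MontgomerySmith2014Otelbaev, Update 3].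
Spaces in `Type` (universe 0). [claim: Otelbaev2013, status: disputed] [cite: Otelbaev2013, Thm 6.1 p.29] -/
def Theorem61 : Prop :=
  ∀ β Cβ θ Cθ : ℝ, β < 0 → θ < -3 / 4 → θ < β →
    ∃ C₁ l : ℝ, ∀ (ι H : Type) [NormedAddCommGroup H] [InnerProductSpace ℝ H] (S : Setting ι H),
      S.Y1 β Cβ → S.Y2 → S.Y3 → S.Y4 →
        ∀ u : H, S.WeakEstimate θ Cθ u → ‖u‖ ≤ C₁ * (1 + ‖S.nl u‖ + ‖S.nl u‖ ^ l)

/-- Charitable PER-SPACE reading of Theorem 6.1 (NOT the print: constants chosen after `(Ĥ, A, L)`):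
`∀ (Ĥ, A, L, β, C_β, θ, C_θ)` with (У.1)–(У.4) `∃ (C₁, l) ∀ ů`. Recorded for the referee's RETYPE (in a fixed
finite-dimensional space it holds trivially with a dimension-dependent constant, p. 62; the `ℓ₂` instance of
[cite: DxdyTopic80156, post 817605] is the published witness against it). [cite: Otelbaev2013, Thm 6.1 p.29 and p.62] -/
def Theorem61PerSpace : Prop :=
  ∀ (ι H : Type) [NormedAddCommGroup H] [InnerProductSpace ℝ H] (S : Setting ι H) (β Cβ θ Cθ : ℝ),
    β < 0 → θ < -3 / 4 → θ < β → S.Y1 β Cβ → S.Y2 → S.Y3 → S.Y4 →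
      ∃ C₁ l : ℝ, ∀ u : H, S.WeakEstimate θ Cθ u → ‖u‖ ≤ C₁ * (1 + ‖S.nl u‖ + ‖S.nl u‖ ^ l)

/-- **THEOREM 6.2 (pp. 72–73), as printed — the statement §7 consumes (Lemma 7.15, p. 84).** "Let
conditions (У.1), (У.2), (У.3) and (У.5) hold. If for some `ů ∈ Ĥ` the weak estimate `‖A^θ ů‖ ≤ C_θ` holds,
where `θ < min(−3/4, β)`, `β` from (У.1), then the strong estimate (6.59) `‖ů‖ ≤ C₂ (1 + ‖f̊‖ + ‖f̊‖^m)`,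
`f̊ = ů + L(ů, ů)`, holds. Here `C₂` and `m` depend only on `C_β, β` from (У.1), on `C_P, n` from (У.5), and
on `C_θ, θ`." Printed proof (p. 73): Theorem 6.1 for `L̃` + (У.5).
[claim: Otelbaev2013, status: disputed] [cite: Otelbaev2013, Thm 6.2 (6.59) pp.72–73] -/
def Theorem62 : Prop :=
  ∀ β Cβ θ Cθ n CP : ℝ, β < 0 → θ < -3 / 4 → θ < β →
    ∃ C₂ m : ℝ, ∀ (ι H : Type) [NormedAddCommGroup H] [InnerProductSpace ℝ H] (S : Setting ι H),
      S.Y1 β Cβ → S.Y2 → S.Y3 → S.Y5 n CP →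
        ∀ u : H, S.WeakEstimate θ Cθ u → ‖u‖ ≤ C₂ * (1 + ‖S.nl u‖ + ‖S.nl u‖ ^ m)

/-- **Step 2 — pp. 71–73: Theorem 6.2 is derived from Theorem 6.1** ("Now we must get rid of condition
(У.4)", p. 71: `L̃(u,v) = (E−P)L((E−P)u,(E−P)v)` satisfies (У.1)–(У.4) whenever `L` satisfies (У.1)–(У.3),
p. 72; "For `L̃` and `A` all conditions of Theorem 6.1 hold … using (6.58) … we obtain (6.59). Theorem 6.2 is
proved", p. 73). Typed as the printed implication. [claim: Otelbaev2013, status: disputed]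
[cite: Otelbaev2013, proof of Thm 6.2 pp.71–73] -/
def Theorem62_of_Theorem61 : Prop :=
  Theorem61 → Theorem62

/-! ## Part III — the abstract problem of Navier–Stokes type (§3, pp. 10–13)

Setting: `H` a separable real Hilbert space; CONDITION A (p. 10): `A` linear, self-adjoint, semibounded below,
with compact resolvent — given here by an orthonormal eigenbasis (p. 11) whose eigenvalues have finite
multiplicity and no finite accumulation point; `μ₀ = λ₁` the least eigenvalue, `A_μ = A − μ₀E + E`,
`A_μ^α` by the spectral decomposition (p. 11); `B(·,·)` a bilinear operator, used on `D(A) × D(A)`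
(Conditions B1–B3 quantify over `u, v ∈ D(A)`); `H₁(0,a) = L²(0,a; H)` (p. 12); problem (3.4)
`u′(t) + Au + B(u,u) = f(t) ∈ H₁(0,a)`, `u(0) = 0`. -/

/-- The data `(H, A, B)` of §3 (pp. 10–12): orthonormal eigenbasis and eigenvalues of `A`, and the (partially
defined) bilinear operator `B`, given as a total function whose values off `D(A) × D(A)` are never used.
[cite: Otelbaev2013, §3 pp.10–12] -/
structure AbsSetting (ι H : Type) [NormedAddCommGroup H] [InnerProductSpace ℝ H] where
  /-- orthonormal eigenbasis `{e_j}` of `A` (p. 11) -/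
  basis : HilbertBasis ι ℝ H
  /-- `A e_j = eig j • e_j` -/
  eig : ι → ℝ
  /-- the bilinear operator `B(·,·)` -/
  B : H → H → H

namespace AbsSetting

variable {ι H : Type} [NormedAddCommGroup H] [InnerProductSpace ℝ H] (T : AbsSetting ι H)

/-- **CONDITION A** (p. 10) in eigen-coordinates: `H` separable (countable eigenbasis) and `A` self-adjoint,
semibounded below, with compact resolvent ⇔ below every level there are only finitely many eigenvalues
counted with multiplicity. [cite: Otelbaev2013, Condition A p.10] -/
def CondA : Prop :=
  Countable ι ∧ ∀ R : ℝ, {i : ι | T.eig i ≤ R}.Finite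

/-- `μ₀` = the exact lower bound of the spectrum = the least eigenvalue (pp. 10–11).
[cite: Otelbaev2013, §3 pp.10–11] -/
def mu0 : ℝ := sInf (range T.eig)

/-- The eigenvalues `λ_j − μ₀ + 1 ≥ 1` of `A_μ = A − μ₀E + E` (p. 11). [cite: Otelbaev2013, §3 p.11] -/
def eigShift (i : ι) : ℝ := T.eig i - T.mu0 + 1

/-- The domain `D(A) = {u : Σ_j λ_j² |u_j|² < ∞}` (p. 11: `Aφ = Σ λ_j φ_j e_j`). [cite: Otelbaev2013, §3 p.11] -/
def domA : Set H := {u | Summable fun i : ι => (T.eig i * ⟪T.basis i, u⟫) ^ 2}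

/-- `w = Au` in coefficients: `⟪e_j, w⟫ = λ_j ⟪e_j, u⟫`. [cite: Otelbaev2013, §3 p.11] -/
def IsApplyA (u w : H) : Prop :=
  ∀ i : ι, ⟪T.basis i, w⟫ = T.eig i * ⟪T.basis i, u⟫

/-- `w = A_μ^s u` in coefficients: `⟪e_j, w⟫ = (λ_j − μ₀ + 1)^s ⟪e_j, u⟫` (p. 11, display after "in the sense
of the spectral decomposition"). [cite: Otelbaev2013, §3 p.11] -/
def IsPowShift (s : ℝ) (u w : H) : Prop :=
  ∀ i : ι, ⟪T.basis i, w⟫ = T.eigShift i ^ s * ⟪T.basis i, u⟫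

/-- "`B(·,·)` is a bilinear operator in `H`" (p. 11), on its domain `D(A) × D(A)`.
[cite: Otelbaev2013, §3 p.11] -/
def Bilin : Prop :=
  ∀ u ∈ T.domA, ∀ v ∈ T.domA, ∀ w ∈ T.domA, ∀ c : ℝ,
    T.B (u + v) w = T.B u w + T.B v w ∧ T.B (c • u) w = c • T.B u w ∧
      T.B w (u + v) = T.B w u + T.B w v ∧ T.B w (c • u) = c • T.B w u

/-- **CONDITION B1** (p. 11, (3.1)): "there is `0 < γ < 1/2` such that for all `u, v ∈ D(A)`
`‖B(u,v)‖ ≤ K_γ (‖A_μ^{γ+1/2} u‖ ‖A_μ^γ v‖ + ‖A_μ^γ u‖ ‖A_μ^{γ+1/2} v‖)`, `K_γ` independent of `u, v`."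
[cite: Otelbaev2013, Condition B1 (3.1) p.11] -/
def B1 : Prop :=
  ∃ γ : ℝ, 0 < γ ∧ γ < 1 / 2 ∧ ∃ K : ℝ, ∀ u ∈ T.domA, ∀ v ∈ T.domA, ∀ w₁ w₂ w₃ w₄ : H,
    T.IsPowShift (γ + 1 / 2) u w₁ → T.IsPowShift γ v w₂ → T.IsPowShift γ u w₃ →
      T.IsPowShift (γ + 1 / 2) v w₄ → ‖T.B u v‖ ≤ K * (‖w₁‖ * ‖w₂‖ + ‖w₃‖ * ‖w₄‖)

/-- **CONDITION B2** (pp. 11–12, (3.2)): "there is `θ ∈ (−3/2, −3/4)` such that for all `u, v ∈ D(A)`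
`‖A^θ B(u,v)‖ ≤ K_θ (‖A_μ^{1/2} u‖ ‖v‖ + ‖u‖ ‖A_μ^{1/2} v‖)`." The power on the left is printed `A^θ`;
typed with `A_μ^θ` (they coincide when `μ₀ = 1`, the case of §4; for `μ₀ ≤ 0` a real power of `A` is not
defined). [cite: Otelbaev2013, Condition B2 (3.2) pp.11–12] -/
def B2 : Prop :=
  ∃ θ : ℝ, -3 / 2 < θ ∧ θ < -3 / 4 ∧ ∃ K : ℝ, ∀ u ∈ T.domA, ∀ v ∈ T.domA, ∀ w wu wv : H,
    T.IsPowShift θ (T.B u v) w → T.IsPowShift (1 / 2) u wu → T.IsPowShift (1 / 2) v wv →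
      ‖w‖ ≤ K * (‖wu‖ * ‖v‖ + ‖u‖ * ‖wv‖)

/-- **CONDITION B3** (p. 12, (3.3)): "for all `u ∈ D(A)`, `⟨B(u,u), u⟩ = 0`."
[cite: Otelbaev2013, Condition B3 (3.3) p.12] -/
def B3 : Prop :=
  ∀ u ∈ T.domA, ⟪T.B u u, u⟫ = 0

/-- "`P` is the orthogonal projector onto the eigenspace `G_{μ₀} = {x : Ax = μ₀x}`" (p. 12), in coefficients.
[cite: Otelbaev2013, §3 p.12] -/
def IsProjBottom (P : H →ₗ[ℝ] H) : Prop :=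
  ∀ (u : H) (i : ι), ⟪T.basis i, P u⟫ = if T.eig i = T.mu0 then ⟪T.basis i, u⟫ else 0

/-- `B̂_P(u) = (E − P) B((E − P)u, (E − P)u) − B(u, u)` (p. 12). [cite: Otelbaev2013, §3 p.12] -/
def hatB (P : H →ₗ[ℝ] H) (u : H) : H :=
  (T.B (u - P u) (u - P u) - P (T.B (u - P u) (u - P u))) - T.B u u

/-- **CONDITION B4** (p. 13): "if `u(t)` is a continuously differentiable vector-function with values in `D(A)`
such that `u(0) = 0`, then `‖B̂_P(u)‖_{H₁} ≤ C ‖u′ + Au + B(u,u)‖²_{H₁}`" (`H₁ = L²(0,a; H)`); typed in `ℝ≥0∞`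
(both sides may be `∞`), `u` continuously differentiable on `[0, a]` as an `H`-valued map, `Au(t)` given by
its coefficients. [cite: Otelbaev2013, Condition B4 p.13] -/
def B4 (a : ℝ) : Prop :=
  ∃ C : ℝ, ∀ P : H →ₗ[ℝ] H, T.IsProjBottom P → ∀ u u' Au : ℝ → H,
    (∀ t ∈ Icc 0 a, HasDerivWithinAt u (u' t) (Icc 0 a) t) → ContinuousOn u' (Icc 0 a) →
      (∀ t ∈ Icc 0 a, u t ∈ T.domA ∧ T.IsApplyA (u t) (Au t)) → u 0 = 0 →
        (∫⁻ t in Ioo 0 a, ‖T.hatB P (u t)‖ₑ ^ 2) ^ (1 / 2 : ℝ) ≤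
          ENNReal.ofReal C * ∫⁻ t in Ioo 0 a, ‖u' t + Au t + T.B (u t) (u t)‖ₑ ^ 2

/-- **Solution of the abstract problem (3.4)** `u′ + Au + B(u,u) = f ∈ H₁(0,a)`, `u(0) = 0` (p. 12), in the
strong sense in which Theorem 2 bounds it (`u′`, `Au ∈ H₁(0,a)`): `u(t) = ∫₀ᵗ u′` on `[0,a]` with
`u′ ∈ L²(0,a;H)` (so `u(0) = 0` and `u` is absolutely continuous), `u(t) ∈ D(A)` and `Au ∈ L²(0,a;H)`, and the
equation holds for a.e. `t ∈ (0,a)`. [cite: Otelbaev2013, (3.4) p.12] -/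
def IsSolution (a : ℝ) (f u u' Au : ℝ → H) : Prop :=
  MemLp u' 2 (volume.restrict (Ioo 0 a)) ∧ MemLp Au 2 (volume.restrict (Ioo 0 a)) ∧
    (∀ t ∈ Icc 0 a, u t = ∫ s in (0 : ℝ)..t, u' s) ∧
    (∀ᵐ t ∂(volume.restrict (Ioo 0 a)), u t ∈ T.domA ∧ T.IsApplyA (u t) (Au t)) ∧
    ∀ᵐ t ∂(volume.restrict (Ioo 0 a)), u' t + Au t + T.B (u t) (u t) = f t

end AbsSetting

/-- The norm of `H₁(0,a) = L²(0,a; H)` (p. 12) as a real number (`toReal`; used next to `MemLp` facts).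
[cite: Otelbaev2013, §3 p.12] -/
def h1Norm {H : Type} [NormedAddCommGroup H] (a : ℝ) (g : ℝ → H) : ℝ :=
  (eLpNorm g 2 (volume.restrict (Ioo 0 a))).toReal

/-- **THEOREM 2, part I (p. 13), as printed.** "Let `A` be a linear and `B(·,·)` a bilinear operator for which
Conditions A and B1–B4 hold. Then (I) for every `f(t) ∈ H₁(0,a)` problem (3.4) has a unique solution `u(t)`,
and it satisfies `sup_{0≤t≤a} ‖A_μ^{1/2} u(t)‖ + ‖u‖_{H₁} + ‖u′‖_{H₁} + ‖u′ + Au‖_{H₁} + ‖B(u,u)‖_{H₁} ≤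
C (1 + ‖f‖_{H₁} + ‖f‖^l_{H₁})`, where `C` and `l` do not depend on `f`." (`‖u‖_{H₁}` is printed twice; the
supremum is typed as an explicit bound `M₀`.) Part II (continuous dependence) is not on the path to
Theorem 1 and is not typed. `a > 0` is the horizon of pp. 7, 12; spaces in `Type`, `H` complete (so that the
Bochner integrals are honest). [claim: Otelbaev2013, status: disputed] [cite: Otelbaev2013, Thm 2 (I) p.13] -/
def Theorem2I : Prop :=
  ∀ a : ℝ, 0 < a → ∀ (ι H : Type) [NormedAddCommGroup H] [InnerProductSpace ℝ H] [CompleteSpace H]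
    (T : AbsSetting ι H), T.CondA → T.Bilin → T.B1 → T.B2 → T.B3 → T.B4 a →
      ∃ C l : ℝ, ∀ f : ℝ → H, MemLp f 2 (volume.restrict (Ioo 0 a)) →
        (∃ u u' Au : ℝ → H, T.IsSolution a f u u' Au ∧ MemLp u 2 (volume.restrict (Ioo 0 a)) ∧
            MemLp (fun t => T.B (u t) (u t)) 2 (volume.restrict (Ioo 0 a)) ∧
            ∃ M₀ : ℝ, (∀ t ∈ Icc 0 a, ∃ w : H, T.IsPowShift (1 / 2) (u t) w ∧ ‖w‖ ≤ M₀) ∧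
              M₀ + h1Norm a u + h1Norm a u' + h1Norm a (fun t => u' t + Au t) +
                  h1Norm a (fun t => T.B (u t) (u t)) ≤
                C * (1 + h1Norm a f + h1Norm a f ^ l)) ∧
        ∀ u₁ u₁' Au₁ u₂ u₂' Au₂ : ℝ → H, T.IsSolution a f u₁ u₁' Au₁ → T.IsSolution a f u₂ u₂' Au₂ →
          ∀ t ∈ Icc 0 a, u₁ t = u₂ t

/-- **Step 3 — §7 (pp. 73–91): "In this section we derive Theorem 2 from Theorem 6.2"** (p. 73, first
sentence of §7); the use of Theorem 6.2 is in Lemma 7.15 (p. 84: with `Ĥ = H₁(0,a)`, `L = B̃` of (7.3),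
conditions (У.1), (У.2), (У.3), (У.5) from Lemmas 7.5, 7.7, 7.8, 7.4), followed by Lemma 7.16 (pp. 84–86),
Lemma 7.17 (pp. 86–90) and the proof of Theorem 2 (pp. 90–91). Typed as the printed implication.
[claim: Otelbaev2013, status: disputed] [cite: Otelbaev2013, §7 p.73 and Lemma 7.15 p.84] -/
def Theorem2_of_Theorem62 : Prop :=
  Theorem62 → Theorem2I

/-- **Step 4 — §4 (pp. 14–23): "Derivation of the main Theorem 1 from Theorem 2"**, closing sentence p. 23:
"Thus Theorem 1 follows from Theorem 2." Content as printed: problem (1.1)–(1.4) is the instance of (3.4)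
with `H = L̃₂(Q)` (divergence-free `2π`-periodic `L₂` fields), `A = E − Δ` (`μ₀ = 1`, `A_μ = A`),
`B(u,v) = eᵗ F⟨u,∇⟩v` after `u = v eᵗ` (p. 17; `F = E + grad (−Δ̃)⁻¹ div`, (4.3)); Condition A and B1
(`γ ∈ (3/8, 1/2)`, pp. 18–19), B2 (pp. 19–20), B3 (pp. 20–21), B4 (pp. 21–23, via Hopf's estimate (2.1))
verified; pressure recovered from (4.4) and (1.4). Typed as the printed implication (the instance is not
built here). [claim: Otelbaev2013, status: disputed] [cite: Otelbaev2013, §4 pp.14–23 (conclusion p.23)] -/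
def Theorem1_of_Theorem2 : Prop :=
  Theorem2I → ClaimedTheorem

/-- **Composition of the printed argument**: Theorem 6.1 (Step 1) ⇒ Theorem 6.2 (Step 2, pp. 71–73) ⇒
Theorem 2 (Step 3, §7) ⇒ Theorem 1 (Step 4, §4). Pure logic; the paper's logic composes, so the locator of
any failure is a Step, not the composition. [cite: Otelbaev2013, §3 p.10 ("we split the proof into several stages") and pp.23, 27, 29, 73] -/
theorem claim_of_steps (h₁ : Theorem61) (h₂ : Theorem62_of_Theorem61) (h₃ : Theorem2_of_Theorem62)
    (h₄ : Theorem1_of_Theorem2) : ClaimedTheorem :=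
  h₄ (h₃ (h₂ h₁))

/-- The printed (uniform) Theorem 6.1 implies its charitable per-space reading. [cite: Otelbaev2013, Thm 6.1 p.29] -/
theorem theorem61PerSpace_of_theorem61 (h : Theorem61) : Theorem61PerSpace := by
  intro ι H _ _ S β Cβ θ Cθ hβ hθ hθβ h1 h2 h3 h4
  obtain ⟨C₁, l, hC⟩ := h β Cβ θ Cθ hβ hθ hθβ
  exact ⟨C₁, l, hC ι H S h1 h2 h3 h4⟩

/-- **The Clay link as a typed delta** (cell TYPING-HYGIENE item 10 (b)). The paper asserts (p. 10, l. 6–9):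
"This theorem gives a complete solution of the sixth Millennium problem … on existence and smoothness of
solutions of the Navier–Stokes equations" — no derivation is printed. The unprinted bridge from Theorem 1
(period `2π`, zero datum, `L₂` force, every finite horizon, `L₂`-strong class, `ν = 1`) to Clay (B)
(`ClayVariants.clayPeriodic.Regularity`: `ℤ³`-periodic smooth datum, `f ≡ 0`, `C^∞` solution on
`ℝ³ × [0,∞)`, every `ν > 0`) is exactly this Prop; its content would be: period/viscosity rescaling (Δ1/Δ7),
smooth datum ↦ zero datum + force (Δ4/Δ3, "without loss of generality", p. 7), `L₂`-strong on every `(0,a)`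
⇒ `C^∞` on `[0,∞)` (Δ5/Δ7). The schema test `ClayVariants.ClaySpec.RegularityAt.mono` does not apply:
`ClaimedTheorem` is not a `ClaySpec` statement (different solution notion and data slot).
[claim: Otelbaev2013, status: disputed] [cite: Otelbaev2013, p.10 lines 6–9] -/
def ClayDelta : Prop :=
  ClaimedTheorem → ClayVariants.clayPeriodic.Regularity

/-- With the unprinted bridge, Theorem 1 would give Clay (B). [cite: Otelbaev2013, p.10 lines 6–9] -/
theorem clay_of_claimed_of_delta (hΔ : ClayDelta) (h : ClaimedTheorem) :
    ClayVariants.clayPeriodic.Regularity :=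
  hΔ h

end Literature.Claims.NS.Otelbaev2013

end

-- WHAT THIS IS NOT: not a claim about NS regularity or blow-up; not a claim about any author beyond the
-- typed locator.
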